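import Mathlib
import HarnessLib
import Literature.Analysis.FluidPDE.ClassicalLocalEnergyCutoff
import Literature.Analysis.ODE.IntegralGronwall
import Summits.NavierStokesRegularity.NavierStokesRegularity.Theorems.QuarterLogPincerTypeIQuantSubcubicExpFluxSlice

/-!
# Crux `QuarterLogPincer.TypeIQuantSubcubicExp` (stmt-NavierStokesRegularity-24077), line `thin_cascade`:
  the weighted uniformly-local Gronwall argument — uniform local energy and dissipation on a window
  from a pointwise bound with integrable weight

Helper file (`--supports stmt-NavierStokesRegularity-24077 --as helper`, lead prover ns-tc-p1 g3) toward
the registered 4th stub `stub_uniformScaledEnergy : UniformScaledEnergy` (skeleton v5).  This is the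
dynamical core of clauses `A` and `E` at unit scale: for a classical solution `(u, p)` of the unforced
Navier–Stokes system (`ν = 1`) on an open time set `S ⊇ [t₀, t₁]` whose slices are in `L²` (uniformly),
bounded pointwise by a continuous weight `m(t) ≥ 0`, with normalised pressure on every slice, the
uniformly local energy `α(t) = sup_{k ∈ ℤ³} ∫ φ_k |u(t)|²` (lattice cut-offs `φ_k = θ_{2,3}(k − ·)`)
satisfies `α(t) ≤ a + ∫_{t₀}^t (a₁ + a₂ m) α` by the local energy identity and the slice flux bound
`exists_flux_le` (`…FluxSlice`), with `a = m(t₀)² |B₃|`; the integral Gronwall lemma of the tree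
(`Literature.Analysis.ODE.gronwall_integral_le_on`, applied to the continuous majorant
`Φ(t) = a + ∫_{t₀}^t (a₁ + a₂ m) α`) gives

  `∫_{B(y,1)} |u(t)|² ≤ B`,  `∫_{t₀}^{t₁} ∫ |∇u|² φ_y ≤ B`,  `B = |B₃| m(t₀)² exp(∫_{t₀}^{t₁} (a₁ + a₂ m))`

for every centre `y` and `t ∈ [t₀, t₁]` (`exists_uloc_gronwall`).  With the Type-I weight
`m(t) = M (T + τ − t)^{-1/2}` on a window of length `≤ 1` ending at `T` the exponent is `≤ a₁ + 2 a₂ M`,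
uniformly in the solution — the content of the stub.

HONEST FRAMING: bookkeeping toward one registered stub of an open crux; nothing about Navier–Stokes
regularity is proved; no summit statement is proved by this file.
-/

noncomputable section

-- the summit-side namespace `Summit.NavierStokesRegularity.NavierStokesRegularity.…` (single-conjunct summit,
-- D-0017) repeats a component by design; the dupNamespace linter would flag every declaration.
set_option linter.dupNamespace false

namespace Summit.NavierStokesRegularity.NavierStokesRegularity.Theorems.ThinCascade

open MeasureTheory Set Function Metric Filter Topology
open scoped ENNReal NNReal ContDiff Laplacian
open Literature.Analysis Literature.Analysis.FluidPDE Literature.Analysis.FluidPDE.JiaSverak2013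

/-! ### The cut-off energy of a classical solution: continuity, size -/

/-- The cut-off energy `t ↦ ∫ φ_y |u(t)|²` of a classical solution is continuous on the (open) time
set. [folklore] -/
theorem continuousOn_cutoffEnergy {S : Set ℝ} (hS : IsOpen S)
    {u : ℝ → EuclideanSpace ℝ (Fin 3) → EuclideanSpace ℝ (Fin 3)} {p : ℝ → EuclideanSpace ℝ (Fin 3) → ℝ}
    (hcl : IsClassicalNSSolutionOn S 1 0 u p) (y : EuclideanSpace ℝ (Fin 3)) :
    ContinuousOn (fun t => ∫ x, radialCutoff 2 3 (y - x) * ‖u t x‖ ^ 2) S :=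
  continuousOn_of_forall_continuousAt fun _ ht =>
    (hcl.hasDerivAt_integral_cutoff_norm_sq hS (contDiff_cutoff_infty y) (hasCompactSupport_cutoff y)
      ht).continuousAt

/-- The cut-off energy is dominated by the global energy: `∫ φ_y |w|² ≤ ∫ |w|²` (in `ℝ≥0∞`). [folklore] -/
theorem ofReal_cutoffEnergy_le {w : EuclideanSpace ℝ (Fin 3) → EuclideanSpace ℝ (Fin 3)}
    (hw : Continuous w) (y : EuclideanSpace ℝ (Fin 3)) :
    ENNReal.ofReal (∫ x, radialCutoff 2 3 (y - x) * ‖w x‖ ^ 2) ≤ ∫⁻ x, ‖w x‖ₑ ^ 2 := by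
  have hint : Integrable (fun x => radialCutoff 2 3 (y - x) * ‖w x‖ ^ 2) :=
    ((contDiff_cutoff_infty y).continuous.mul (hw.norm.pow 2)).integrable_of_hasCompactSupport
      ((hasCompactSupport_cutoff y).mul_right)
  rw [ofReal_integral_eq_lintegral_ofReal hint (ae_of_all _ fun x =>
    mul_nonneg (testFn_nonneg y x) (sq_nonneg _))]
  refine lintegral_mono fun x => ?_
  rw [← ofReal_norm, ← ENNReal.ofReal_pow (norm_nonneg _)]
  exact ENNReal.ofReal_le_ofReal (by
    calc radialCutoff 2 3 (y - x) * ‖w x‖ ^ 2 ≤ 1 * ‖w x‖ ^ 2 :=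
        mul_le_mul_of_nonneg_right (testFn_le_one y x) (sq_nonneg _)
      _ = ‖w x‖ ^ 2 := one_mul _)

/-- A continuous slice with `∫ |w|² < ∞` is in `L²`. [folklore] -/
theorem memLp_two_of_lintegral_ne_top {w : EuclideanSpace ℝ (Fin 3) → EuclideanSpace ℝ (Fin 3)}
    (hw : Continuous w) (h : ∫⁻ x, ‖w x‖ₑ ^ 2 ≠ ⊤) : MemLp w 2 volume := by
  refine ⟨hw.aestronglyMeasurable, ?_⟩
  rw [eLpNorm_eq_lintegral_rpow_enorm_toReal (by norm_num) (by norm_num), ENNReal.toReal_ofNat]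
  have e : ∫⁻ x, ‖w x‖ₑ ^ (2 : ℝ) = ∫⁻ x, ‖w x‖ₑ ^ 2 :=
    lintegral_congr fun x => by rw [show (2 : ℝ) = ((2 : ℕ) : ℝ) by norm_num, ENNReal.rpow_natCast]
  rw [e]
  exact ENNReal.rpow_lt_top_of_nonneg (by norm_num) h

/-! ### The weighted uniformly-local Gronwall bound -/

/-- **Uniform local energy and dissipation on a window from a pointwise bound with integrable
weight (the weighted `L²_uloc` Gronwall argument).**  There are universal `a₀, a₁, a₂ ≥ 0` such that:
for a classical solution `(u, p)` of the unforced Navier–Stokes system with `ν = 1` on an open time set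
`S`, a window `[t₀, t₁] ⊆ S`, a uniform bound `∫ |u(t)|² ≤ E₀ < ∞` on the window, a continuous weight
`m ≥ 0` with `‖u(t, x)‖ ≤ m(t)` on the window, and normalised pressure on every slice of the window
(`p(t) = Π[u(t)] + C(t)` a.e.), one has for every centre `y` and every `t ∈ [t₀, t₁]`
`∫_{B(y,1)} |u(t)|² ≤ B` and `∫_{t₀}^{t₁} ∫ |∇u(s)|²_F φ_y ds ≤ B`, where
`B = a₀ m(t₀)² exp(∫_{t₀}^{t₁} (a₁ + a₂ m(s)) ds)`.
Proof: local energy identity tested with the lattice cut-offs, slice flux bound `exists_flux_le`,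
supremum over the lattice, and the integral Gronwall lemma for the continuous majorant. [folklore] -/
theorem exists_uloc_gronwall :
    ∃ a₀ a₁ a₂ : ℝ, 0 ≤ a₀ ∧ 0 ≤ a₁ ∧ 0 ≤ a₂ ∧
      ∀ {S : Set ℝ} {u : ℝ → EuclideanSpace ℝ (Fin 3) → EuclideanSpace ℝ (Fin 3)}
        {p : ℝ → EuclideanSpace ℝ (Fin 3) → ℝ}, IsOpen S → IsClassicalNSSolutionOn S 1 0 u p →
        ∀ {t₀ t₁ : ℝ}, t₀ ≤ t₁ → Icc t₀ t₁ ⊆ S →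
        ∀ {E₀ : ℝ≥0∞}, E₀ ≠ ⊤ → (∀ t ∈ Icc t₀ t₁, ∫⁻ x, ‖u t x‖ₑ ^ 2 ≤ E₀) →
        ∀ {m : ℝ → ℝ}, Continuous m → (∀ s, 0 ≤ m s) → (∀ t ∈ Icc t₀ t₁, ∀ x, ‖u t x‖ ≤ m t) →
        (∀ t ∈ Icc t₀ t₁, ∃ C : ℝ, ∀ᵐ x ∂(volume : Measure (EuclideanSpace ℝ (Fin 3))),
          p t x = rieszPressure (u t) x + C) →
        ∀ (y : EuclideanSpace ℝ (Fin 3)) (t : ℝ), t ∈ Icc t₀ t₁ →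
          (∫⁻ x in ball y 1, ‖u t x‖ₑ ^ 2 ≤
              ENNReal.ofReal (a₀ * m t₀ ^ 2 * Real.exp (∫ s in t₀..t₁, (a₁ + a₂ * m s)))) ∧
          (∫ s in t₀..t₁, ∫ x, frobeniusNormSq (fderiv ℝ (u s) x) * radialCutoff 2 3 (y - x) ≤
              a₀ * m t₀ ^ 2 * Real.exp (∫ s in t₀..t₁, (a₁ + a₂ * m s))) := by
  obtain ⟨a₁, a₂, ha₁, ha₂, hflux⟩ := exists_flux_le
  set V₃ : ℝ := (volume (ball (0 : EuclideanSpace ℝ (Fin 3)) 3)).toReal with hV₃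
  refine ⟨V₃, a₁, a₂, ENNReal.toReal_nonneg, ha₁, ha₂, ?_⟩
  intro S u p hS hcl t₀ t₁ ht₀₁ hI E₀ hE₀ hE m hmc hm0 hum hp y t ht
  -- ## notation
  set φ : EuclideanSpace ℝ (Fin 3) → EuclideanSpace ℝ (Fin 3) → ℝ :=
    fun z x => radialCutoff 2 3 (z - x) with hφ
  set e : EuclideanSpace ℝ (Fin 3) → ℝ → ℝ := fun z s => ∫ x, φ z x * ‖u s x‖ ^ 2 with he
  set flux : EuclideanSpace ℝ (Fin 3) → ℝ → ℝ := fun z s =>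
    ∫ x, ((1 : ℝ) * ((Δ (φ z)) x * ‖u s x‖ ^ 2) + fderiv ℝ (φ z) x (u s x) * ‖u s x‖ ^ 2 +
      2 * (p s x * fderiv ℝ (φ z) x (u s x))) with hfluxdef
  set D : EuclideanSpace ℝ (Fin 3) → ℝ → ℝ := fun z s =>
    ∫ x, frobeniusNormSq (fderiv ℝ (u s) x) * φ z x with hD
  set wt : ℝ → ℝ := fun s => a₁ + a₂ * m s with hwt
  -- the integer lattice of centres (every point is within distance `< 1` of it)
  set latt : (Fin 3 → ℤ) → EuclideanSpace ℝ (Fin 3) :=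
    fun k => (WithLp.equiv 2 (Fin 3 → ℝ)).symm fun i => (k i : ℝ) with hlatt
  have exists_latt_dist_lt : ∀ x : EuclideanSpace ℝ (Fin 3), ∃ k : Fin 3 → ℤ, dist x (latt k) < 1 :=
    fun x => exists_lattice_dist_lt x
  set αE : ℝ → ℝ≥0∞ := fun s => ⨆ k : Fin 3 → ℤ, ENNReal.ofReal (e (latt k) s) with hαE
  set α : ℝ → ℝ := fun s => (αE s).toReal with hα
  set a : ℝ := V₃ * m t₀ ^ 2 with ha
  set W : ℝ := ∫ s in t₀..t₁, wt s with hW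
  -- ## basic facts
  have hwt0 : ∀ s, 0 ≤ wt s := fun s => add_nonneg ha₁ (mul_nonneg ha₂ (hm0 s))
  have hwtc : Continuous wt := continuous_const.add (continuous_const.mul hmc)
  have huc : ∀ s ∈ S, Continuous (u s) := fun s hs => (hcl.contDiff_velocity hs).continuous
  have he0 : ∀ z s, 0 ≤ e z s := fun z s => integral_nonneg fun x =>
    mul_nonneg (testFn_nonneg z x) (sq_nonneg _)
  -- `αE s ≤ E₀` on the window, hence finite; `α s ≤ E₀.toReal`
  have hαE_le : ∀ s ∈ Icc t₀ t₁, αE s ≤ E₀ := fun s hs =>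
    iSup_le fun k => (ofReal_cutoffEnergy_le (huc s (hI hs)) _).trans (hE s hs)
  have hαE_top : ∀ s ∈ Icc t₀ t₁, αE s ≠ ⊤ := fun s hs => ne_top_of_le_ne_top hE₀ (hαE_le s hs)
  have hα_le : ∀ s ∈ Icc t₀ t₁, α s ≤ E₀.toReal := fun s hs => ENNReal.toReal_mono hE₀ (hαE_le s hs)
  have hα0 : ∀ s, 0 ≤ α s := fun s => ENNReal.toReal_nonneg
  -- unit-ball energies are `≤ αE s`
  have hball : ∀ s ∈ Icc t₀ t₁, ∀ z : EuclideanSpace ℝ (Fin 3),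
      ∫⁻ x in ball z 1, ‖u s x‖ₑ ^ 2 ≤ αE s := by
    intro s hs z
    obtain ⟨k, hk⟩ := exists_latt_dist_lt z
    exact (lintegral_ball_le_ofReal_cutoffEnergy (huc s (hI hs)) hk).trans (le_iSup (fun k =>
      ENNReal.ofReal (e (latt k) s)) k)
  -- `L²` slices
  have hL2 : ∀ s ∈ Icc t₀ t₁, MemLp (u s) 2 volume := fun s hs =>
    memLp_two_of_lintegral_ne_top (huc s (hI hs)) (ne_top_of_le_ne_top hE₀ (hE s hs))
  -- ## the slice flux bound: `flux z s ≤ wt s * α s`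
  have hflux_le : ∀ s ∈ Icc t₀ t₁, ∀ z, flux z s ≤ wt s * α s := by
    intro s hs z
    have h := hflux hcl (hI hs) (hL2 s hs) (hum s hs) (hp s hs) (hαE_top s hs) (hball s hs) z
    exact h
  -- ## measurability and integrability of `wt * α` on the window
  have he_cont : ∀ z, ContinuousOn (e z) (Icc t₀ t₁) := fun z =>
    (continuousOn_cutoffEnergy hS hcl z).mono hI
  have hαE_meas : AEMeasurable αE (volume.restrict (Icc t₀ t₁)) := by
    refine AEMeasurable.iSup fun k => ?_
    exact (ENNReal.continuous_ofReal.comp_continuousOn (he_cont (latt k))).aemeasurable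
      measurableSet_Icc
  have hα_meas : AEMeasurable α (volume.restrict (Icc t₀ t₁)) := hαE_meas.ennreal_toReal
  have hwtα_int : IntegrableOn (fun s => wt s * α s) (Icc t₀ t₁) volume := by
    obtain ⟨Mw, hMw⟩ := isCompact_Icc.exists_bound_of_continuousOn (hwtc.continuousOn (s := Icc t₀ t₁))
    refine IntegrableOn.of_bound (by rw [Real.volume_Icc]; exact ENNReal.ofReal_lt_top)
      ((hwtc.aemeasurable.restrict.mul hα_meas).aestronglyMeasurable) (Mw * E₀.toReal) ?_
    refine (ae_restrict_mem measurableSet_Icc).mono fun s hs => ?_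
    rw [Real.norm_of_nonneg (mul_nonneg (hwt0 s) (hα0 s))]
    exact mul_le_mul ((le_abs_self _).trans ((Real.norm_eq_abs _).symm.le.trans (hMw s hs)))
      (hα_le s hs) (hα0 s) ((norm_nonneg _).trans (hMw s hs))
  have hwtα_ii : ∀ {c d : ℝ}, c ∈ Icc t₀ t₁ → d ∈ Icc t₀ t₁ →
      IntervalIntegrable (fun s => wt s * α s) volume c d := fun hc hd =>
    (hwtα_int.mono_set (uIcc_subset_Icc hc hd)).intervalIntegrable
  -- ## the energy inequality at every centre: `e z t' + 2 ∫ D ≤ a + ∫ wt α`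
  have henergy : ∀ z, ∀ t' ∈ Icc t₀ t₁,
      e z t' + 2 * ∫ s in t₀..t', D z s ≤ a + ∫ s in t₀..t', wt s * α s := by
    intro z t' ht'
    have hI' : Icc t₀ t' ⊆ S := (Icc_subset_Icc_right ht'.2).trans hI
    have hid := hcl.local_energy_identity_cutoff hS (contDiff_cutoff_infty z)
      (hasCompactSupport_cutoff z) ht'.1 hI'
    -- `∫ flux ≤ ∫ wt α`
    have hfi : IntervalIntegrable (flux z) volume t₀ t' := by
      refine ContinuousOn.intervalIntegrable ?_
      rw [uIcc_of_le ht'.1]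
      exact (hcl.continuousOn_integral_flux_cutoff (contDiff_cutoff_infty z)
        (hasCompactSupport_cutoff z)).mono hI'
    have hmono : ∫ s in t₀..t', flux z s ≤ ∫ s in t₀..t', wt s * α s :=
      intervalIntegral.integral_mono_on ht'.1 hfi (hwtα_ii (left_mem_Icc.2 ht₀₁) ht')
        fun s hs => hflux_le s ⟨hs.1, hs.2.trans ht'.2⟩ z
    -- initial cut-off energy `≤ a`
    have hinit : e z t₀ ≤ a := by
      have h := cutoffEnergy_le (huc t₀ (hI (left_mem_Icc.2 ht₀₁))) (hum t₀ (left_mem_Icc.2 ht₀₁)) z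
      rw [ha, hV₃, mul_comm]
      exact h
    have hid' : e z t' - e z t₀ + 2 * 1 * ∫ s in t₀..t', D z s = ∫ s in t₀..t', flux z s := hid
    linarith
  have hD0 : ∀ z, ∀ t' ∈ Icc t₀ t₁, 0 ≤ ∫ s in t₀..t', D z s := fun z t' ht' =>
    intervalIntegral.integral_nonneg ht'.1 fun s _ => integral_nonneg fun x =>
      mul_nonneg (frobeniusNormSq_nonneg _) (testFn_nonneg z x)
  -- ## the continuous majorant `Φ`
  set F : ℝ → ℝ := (Icc t₀ t₁).indicator fun s => wt s * α s with hF
  have hFint : Integrable F volume := hwtα_int.integrable_indicator measurableSet_Icc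
  set Φ : ℝ → ℝ := fun t' => a + ∫ s in t₀..t', F s with hΦ
  have hΦc : Continuous Φ :=
    continuous_const.add (intervalIntegral.continuous_primitive (fun _ _ => hFint.intervalIntegrable) t₀)
  have hΦeq : ∀ t' ∈ Icc t₀ t₁, Φ t' = a + ∫ s in t₀..t', wt s * α s := by
    intro t' ht'
    simp only [hΦ]
    congr 1
    refine intervalIntegral.integral_congr fun s hs => ?_
    rw [uIcc_of_le ht'.1] at hs
    simp only [hF]
    rw [indicator_of_mem (show s ∈ Icc t₀ t₁ from ⟨hs.1, hs.2.trans ht'.2⟩)]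
  -- `α ≤ Φ` on the window
  have hαΦ : ∀ t' ∈ Icc t₀ t₁, α t' ≤ Φ t' := by
    intro t' ht'
    rw [hΦeq t' ht']
    have hnonneg : 0 ≤ a + ∫ s in t₀..t', wt s * α s :=
      add_nonneg (by rw [ha]; positivity) (intervalIntegral.integral_nonneg ht'.1 fun s _ =>
        mul_nonneg (hwt0 s) (hα0 s))
    simp only [hα]
    rw [← ENNReal.ofReal_toReal (hαE_top t' ht')]
    rw [ENNReal.toReal_ofReal ENNReal.toReal_nonneg]
    have : αE t' ≤ ENNReal.ofReal (a + ∫ s in t₀..t', wt s * α s) := by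
      refine iSup_le fun k => ENNReal.ofReal_le_ofReal ?_
      linarith [henergy (latt k) t' ht', hD0 (latt k) t' ht']
    calc (αE t').toReal ≤ (ENNReal.ofReal (a + ∫ s in t₀..t', wt s * α s)).toReal :=
        ENNReal.toReal_mono ENNReal.ofReal_ne_top this
      _ = a + ∫ s in t₀..t', wt s * α s := ENNReal.toReal_ofReal hnonneg
  -- `Φ ≤ a + ∫ wt Φ` on the window
  have hΦineq : ∀ t' ∈ Icc t₀ t₁, Φ t' ≤ a + ∫ s in t₀..t', wt s * Φ s := by
    intro t' ht'
    rw [hΦeq t' ht']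
    have hmono : ∫ s in t₀..t', wt s * α s ≤ ∫ s in t₀..t', wt s * Φ s :=
      intervalIntegral.integral_mono_on ht'.1 (hwtα_ii (left_mem_Icc.2 ht₀₁) ht')
        ((hwtc.mul hΦc).intervalIntegrable _ _)
        fun s hs => mul_le_mul_of_nonneg_left (hαΦ s ⟨hs.1, hs.2.trans ht'.2⟩) (hwt0 s)
    linarith
  -- ## Gronwall for `Φ`, shifted to `[0, t₁ - t₀]`
  have hG := Literature.Analysis.ODE.gronwall_integral_le_on (T := t₁ - t₀)
    (a := fun σ => wt (t₀ + σ)) (g := fun σ => Φ (t₀ + σ)) (h := fun _ => a)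
    (hwtc.comp (continuous_const.add continuous_id)) (hΦc.comp (continuous_const.add continuous_id))
    (fun σ => hwt0 _) (fun _ _ _ _ _ => le_rfl) (by
      intro σ hσ
      have ht' : t₀ + σ ∈ Icc t₀ t₁ := ⟨by linarith [hσ.1], by linarith [hσ.2]⟩
      have e1 : ∫ s in (0 : ℝ)..σ, wt (t₀ + s) * Φ (t₀ + s) = ∫ s in t₀..t₀ + σ, wt s * Φ s := by
        have := intervalIntegral.integral_comp_add_left (fun s => wt s * Φ s) t₀ (a := 0) (b := σ)
        simpa only [add_zero] using this
      rw [e1]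
      exact hΦineq (t₀ + σ) ht')
  -- ## the bound `B`
  have hWmono : ∀ t' ∈ Icc t₀ t₁, ∫ s in t₀..t', wt s ≤ W := fun t' ht' =>
    intervalIntegral.integral_mono_interval le_rfl ht'.1 ht'.2
      (ae_of_all _ fun s => hwt0 s) (hwtc.intervalIntegrable _ _)
  have ha0 : 0 ≤ a := by rw [ha]; positivity
  have hΦB : ∀ t' ∈ Icc t₀ t₁, Φ t' ≤ a * Real.exp W := by
    intro t' ht'
    have h := hG (t' - t₀) ⟨by linarith [ht'.1], by linarith [ht'.2]⟩
    simp only [add_sub_cancel] at h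
    have e1 : ∫ s in (0 : ℝ)..t' - t₀, wt (t₀ + s) = ∫ s in t₀..t', wt s := by
      have := intervalIntegral.integral_comp_add_left (fun s => wt s) t₀ (a := 0) (b := t' - t₀)
      simpa only [add_zero, add_sub_cancel] using this
    rw [e1] at h
    exact h.trans (mul_le_mul_of_nonneg_left (Real.exp_le_exp.2 (hWmono t' ht')) ha0)
  have hB : a * Real.exp W = V₃ * m t₀ ^ 2 * Real.exp (∫ s in t₀..t₁, (a₁ + a₂ * m s)) := by
    rw [ha, hW]
  -- ## conclusions
  constructor
  · -- local energy at time `t`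
    calc ∫⁻ x in ball y 1, ‖u t x‖ₑ ^ 2 ≤ αE t := hball t ht y
      _ = ENNReal.ofReal (α t) := (ENNReal.ofReal_toReal (hαE_top t ht)).symm
      _ ≤ ENNReal.ofReal (V₃ * m t₀ ^ 2 * Real.exp (∫ s in t₀..t₁, (a₁ + a₂ * m s))) := by
          rw [← hB]
          exact ENNReal.ofReal_le_ofReal ((hαΦ t ht).trans (hΦB t ht))
  · -- dissipation on the window
    have h1 := henergy y t₁ (right_mem_Icc.2 ht₀₁)
    have h2 : a + ∫ s in t₀..t₁, wt s * α s ≤ a * Real.exp W := by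
      rw [← hΦeq t₁ (right_mem_Icc.2 ht₀₁)]
      exact hΦB t₁ (right_mem_Icc.2 ht₀₁)
    have h3 := he0 y t₁
    have h4 := hD0 y t₁ (right_mem_Icc.2 ht₀₁)
    rw [← hB]
    change ∫ s in t₀..t₁, D y s ≤ a * Real.exp W
    linarith

end Summit.NavierStokesRegularity.NavierStokesRegularity.Theorems.ThinCascade

end
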